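import Summits.CriticalPhenomena.PercolationContinuityZ3.Theorems.PercNearOneGluingNearOneGluingPocketBound
import Literature.Probability.Percolation.KozmaNitzanThm4Witness
import HarnessLib

/-!
# `NoHeavyLowerTail` (stmt-CriticalPhenomena-4575) — THE POCKET BOUND WITH ITS WITNESS EXPOSED

Support file (engine seat `prim-cplus-engine` gen 9, 2026-08-20; `--supports stmt-CriticalPhenomena-4575`).
No definitions, no named facts, no sorries.

`μ = prodBernoulli w` on the pairs of `Fin n`; relays `A`, observer `o`, target `b`; the RELAY-FREE POCKET of
`o` is `P(ω) = {v | o ↔ v inside Aᶜ}`; for a candidate value `S₀ ∋ o` (disjoint from `A`) write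
`Pock S₀ = {P(ω) = S₀}`, `Span S₀ = {every v ∈ S₀ is joined to o inside S₀}`, `Cl S₀ = {every pair from S₀ to a
vertex outside S₀ ∪ A is closed}` (so `Pock ⊆ Span ∩ Cl`, `μ(Span ∩ Cl) = μ(Span) μ(Cl)`), and call `p ∈ A` a PORT of
`S₀` if some pair `s(x, p)`, `x ∈ S₀`, has positive weight.

The tree's `pocketBound` (`…NearOneGluingPocketBound.lean`, crux 4574 line, 2026-08-16) contracts the pocket to the
point `o` (merge map `Φ` of `…PocketBoundAux.lean`, law `prodBernoulli w'`) and feeds Kozma–Nitzan's depth-one gluing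
— taken there as a HYPOTHESIS — with the WORST merged-world relay, ending in `Σ_{S₀} min(μ(Pock S₀), t·μ(Span S₀))`.
Here the same contraction is fed with `Literature…KozmaNitzan2024_thm4_witness` (Theorem 4 with the witness of its
proof), which is PROVED, and the witness is kept:

* `PocketWitness.pocket_term_le_witness` — for EVERY relay-or-vertex `a₀ ∉ S₀` that is at most as connected to `b`
  AVOIDING `S₀` as every port of `S₀` (`μ(a₀ ↔ b in S₀ᶜ) ≤ μ(p ↔ b in S₀ᶜ)`):
      `μ({o ↔ A, o ↮ b} ∩ Pock S₀) ≤ μ(Span S₀) · μ(Cl S₀ ∩ {a₀ ↮ b})`.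
  (`μ(Span)·μ(Cl ∩ {a₀ ↮ b}) = μ(Pock-world) × μ(a₀ ↮ b | ∂S₀ closed)`: the designated relay's deadness in the
  world where the realised closed Steiner boundary of the pocket is deleted.)
* `pocketWitnessBound` — summed over the pocket values, for any valid witness RULE `S₀ ↦ a S₀`:
      `μ(o ↔ A, o ↮ b) ≤ Σ_{S₀ ∋ o, S₀ ∩ A = ∅} min( μ(Pock S₀), μ(Span S₀) · μ(Cl S₀ ∩ {a S₀ ↮ b}) )`.
* `pocketBound_holds` — the conclusion of the tree's `pocketBound` UNCONDITIONALLY (its depth-one-gluing hypothesis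
  discharged): witness `a S₀ := argmin_{A} μ(· ↔ b in S₀ᶜ)`, and `μ(Cl ∩ {a ↮ b}) ≤ μ(a ↮ b) ≤ t`.

Why the witness matters (memo ENGINE-g9.md of the seat, exact numerics `work/num/`): with the WORST relay the
intermediate quantity `Σ_{S₀} μ(Pock S₀)·max_{a∈A} μ_{S₀-world}(a ↮ b)` is NOT `O(t)` (private-leaf stars: ratio
`(1 − q^d)/(1 − q)` to `t`), whereas with the weakest-avoiding-`S₀` witness (this file) or the weakest PORT it stays
`≈ t` on every family tried — this is the b-form of the lead's selection inequality (SEL, LEAD-GEN5 §4b): the crux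
follows from `Σ_{S₀} μ(Span S₀)·μ(Cl S₀ ∩ {a(S₀) ↮ b}) ≤ C·max_a μ(a ↮ b) (+ C·μ(o ↮ A))` for one valid rule `a`.
[cite: KozmaNitzan2024, Thm. 4 (p. 12), Lemma 5 (p. 13), Conj. 3 (p. 15)]
-/

namespace Summit.CriticalPhenomena.PercolationContinuityZ3.Theorems

open scoped BigOperators Classical
open MeasureTheory Set
open Literature.Probability.LatticeModels (prodBernoulli prodBernoulli_real_inter_of_determinedBy)
open Literature.Probability.Percolation

namespace PocketWitness

section Walks

variable {n : ℕ} {S₀ A : Finset (Fin n)} {o : Fin n}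
  {Φ : Set (Sym2 (Fin n)) → Set (Sym2 (Fin n))}

/-- **Walk lemma: connectivity avoiding `o` in the merged world is connectivity avoiding `S₀`.**  For
`x, y ∉ S₀`: `Φ ω ∈ {x ↔ y in {o}ᶜ} ↔ ω ∈ {x ↔ y in S₀ᶜ}` (a merged pair avoiding `o` is an original pair avoiding
`S₀`, and conversely). [this file] -/
theorem merge_mem_openConnIn_iff
    (hΦ' : ∀ ω u v, s(u, v) ∈ Φ ω ↔ (u ∉ S₀ ∧ v ∉ S₀ ∧ s(u, v) ∈ ω) ∨
      (u = o ∧ v ∈ A ∧ ∃ x ∈ S₀, s(x, v) ∈ ω) ∨ (v = o ∧ u ∈ A ∧ ∃ x ∈ S₀, s(x, u) ∈ ω))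
    (ho : o ∈ S₀) {x y : Fin n} (hx : x ∉ S₀) (ω : Set (Sym2 (Fin n))) :
    Φ ω ∈ openConnIn ({o}ᶜ : Set (Fin n)) x y ↔ ω ∈ openConnIn ((↑S₀ : Set (Fin n))ᶜ) x y := by
  rw [DCT16.mem_openConnIn_iff_pathIn, DCT16.mem_openConnIn_iff_pathIn]
  have hxS : x ∈ ((↑S₀ : Set (Fin n))ᶜ) := fun h => hx (Finset.mem_coe.1 h)
  have hxo : x ∈ (({o} : Set (Fin n))ᶜ) := fun h => hx ((Set.mem_singleton_iff.1 h) ▸ ho)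
  constructor
  · intro hp
    refine DCT16.pathIn_induction (fun z => PathIn (openGraph ω) ((↑S₀ : Set (Fin n))ᶜ) x z) hp
      (PathIn.refl hxS) ?_
    intro u v hu hv hPu huv
    rw [openGraph_adj] at huv
    obtain ⟨huv, hne⟩ := huv
    have huo : u ≠ o := fun h => hu (Set.mem_singleton_iff.2 h)
    have hvo : v ≠ o := fun h => hv (Set.mem_singleton_iff.2 h)
    rcases (hΦ' ω u v).1 huv with ⟨-, hvS, h⟩ | ⟨h, -⟩ | ⟨h, -⟩
    · refine hPu.tail ?_ (fun h' => hvS (Finset.mem_coe.1 h'))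
      rw [openGraph_adj]
      exact ⟨h, hne⟩
    · exact absurd h huo
    · exact absurd h hvo
  · intro hp
    refine DCT16.pathIn_induction (fun z => PathIn (openGraph (Φ ω)) (({o} : Set (Fin n))ᶜ) x z) hp
      (PathIn.refl hxo) ?_
    intro u v hu hv hPu huv
    rw [openGraph_adj] at huv
    obtain ⟨huv, hne⟩ := huv
    have huS : u ∉ S₀ := fun h => hu (Finset.mem_coe.2 h)
    have hvS : v ∉ S₀ := fun h => hv (Finset.mem_coe.2 h)
    refine hPu.tail ?_ (fun h' => hvS ((Set.mem_singleton_iff.1 h') ▸ ho))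
    rw [openGraph_adj]
    exact ⟨(hΦ' ω u v).2 (Or.inl ⟨huS, hvS, huv⟩), hne⟩

end Walks

section Main

variable {n : ℕ}

/-- **Per-pocket bound with the witness exposed.**  Pocket value `S₀ ∋ o` disjoint from `A`, merge data
`π, Φ, w'`, boundary pair set `F₀` (as in `pocket_term_le`), and a witness `a₀ ∉ S₀` with
`μ(a₀ ↔ b in S₀ᶜ) ≤ μ(p ↔ b in S₀ᶜ)` for every port `p` of `S₀`.  Then
`μ({o ↔ A, o ↮ b} ∩ {pocket = S₀}) ≤ μ(S₀ internally o-spanned) · μ({∂S₀ closed} ∩ {a₀ ↮ b})`.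
Proof: as `pocket_term_le` up to the heart, where Kozma–Nitzan's Theorem 4 WITH WITNESS is applied in the merged
world `prodBernoulli w'` (there `o` is one-layer, its ports are the ports of `S₀`, and `μ'(· ↔ b in {o}ᶜ) =
μ(· ↔ b in S₀ᶜ)` by `merge_mem_openConnIn_iff`), giving `μ'(bad) ≤ μ'(a₀ ↮ b)`, and
`μ(∂S₀ closed)·μ'(a₀ ↮ b) = μ({∂S₀ closed} ∩ Φ⁻¹{a₀ ↮ b}) ≤ μ({∂S₀ closed} ∩ {a₀ ↮ b})` (`merge_mem_openConn`).
[this file] -/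
theorem pocket_term_le_witness
    (w : Sym2 (Fin n) → unitInterval) {S₀ A : Finset (Fin n)} {o b : Fin n}
    (ho : o ∈ S₀) (hSA : Disjoint S₀ A)
    {π : Sym2 (Fin n) → Option (Sym2 (Fin n))} {Φ : Set (Sym2 (Fin n)) → Set (Sym2 (Fin n))}
    {w' : Sym2 (Fin n) → unitInterval} {F₀ : Finset (Sym2 (Fin n))}
    (hπ1 : ∀ x y, x ∉ S₀ → y ∉ S₀ → π s(x, y) = some s(x, y))
    (hπ2 : ∀ x y, x ∈ S₀ → y ∈ A → π s(x, y) = some s(o, y))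
    (hπ3 : ∀ x y k, π s(x, y) = some k → (x ∉ S₀ ∧ y ∉ S₀ ∧ k = s(x, y)) ∨
      (x ∈ S₀ ∧ y ∈ A ∧ k = s(o, y)) ∨ (y ∈ S₀ ∧ x ∈ A ∧ k = s(o, x)))
    (hΦ : ∀ ω k, k ∈ Φ ω ↔ ∃ e ∈ ω, π e = some k)
    (hw' : ∀ k, (w' k : ℝ) = 1 - ∏ e ∈ Finset.univ.filter (fun e => π e = some k), (1 - (w e : ℝ)))
    (hF₀ : ∀ x y, s(x, y) ∈ F₀ ↔ (x ∈ S₀ ∧ y ∉ S₀ ∧ y ∉ A) ∨ (y ∈ S₀ ∧ x ∉ S₀ ∧ x ∉ A))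
    {a₀ : Fin n} (ha₀ : a₀ ∉ S₀)
    (hdom : ∀ p ∈ A, (∃ x ∈ S₀, w s(x, p) ≠ 0) →
      (prodBernoulli w).real (openConnIn ((↑S₀ : Set (Fin n))ᶜ) a₀ b) ≤
        (prodBernoulli w).real (openConnIn ((↑S₀ : Set (Fin n))ᶜ) p b)) :
    (prodBernoulli w).real (((⋃ a ∈ A, openConn o a) ∩ (openConn o b)ᶜ) ∩
        {ω | ∀ v : Fin n, ω ∈ openConnIn (↑A : Set (Fin n))ᶜ o v ↔ v ∈ S₀}) ≤
      (prodBernoulli w).real {ω | ∀ v ∈ S₀, ω ∈ openConnIn (↑S₀ : Set (Fin n)) o v} *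
        (prodBernoulli w).real ({ω | ∀ e ∈ F₀, e ∉ ω} ∩ (openConn a₀ b)ᶜ) := by
  set μ := prodBernoulli w with hμ
  set Span : Set (Set (Sym2 (Fin n))) := {ω | ∀ v ∈ S₀, ω ∈ openConnIn (↑S₀ : Set (Fin n)) o v}
    with hSpan
  set Cl : Set (Set (Sym2 (Fin n))) := {ω | ∀ e ∈ F₀, e ∉ ω} with hCl
  set Bad : Set (Set (Sym2 (Fin n))) := (⋃ a ∈ A, openConn o a) ∩ (openConn o b)ᶜ with hBad
  set Pock : Set (Set (Sym2 (Fin n))) :=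
    {ω | ∀ v : Fin n, ω ∈ openConnIn (↑A : Set (Fin n))ᶜ o v ↔ v ∈ S₀} with hPock
  -- the case `b ∈ S₀`: the event is empty
  by_cases hbS : b ∈ S₀
  · have h0 : Bad ∩ Pock ⊆ ∅ := fun ω ⟨hbad, hω⟩ =>
      hbad.2 (openConnIn_subset_openConn _ o b (mem_openConnIn_of_pocket hω hbS))
    refine le_trans (measureReal_mono h0) ?_
    rw [measureReal_empty]
    exact mul_nonneg measureReal_nonneg measureReal_nonneg
  have hoA : o ∉ A := fun h => Finset.disjoint_left.1 hSA ho h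
  have ha₀o : a₀ ≠ o := fun h => ha₀ (h ▸ ho)
  have hΦ' := mk_mem_merge_iff hπ1 hπ2 hπ3 hΦ
  have hkey : ∀ Y, μ.real (Φ ⁻¹' Y) = (prodBernoulli w').real Y :=
    prodBernoulli_real_preimage_fiberMap w w' π Φ hΦ hw'
  have hdetΦ : ∀ Y, DeterminedBy (Φ ⁻¹' Y) (↑(S₀.sym2 ∪ F₀)ᶜ : Set (Sym2 (Fin n))) :=
    determinedBy_preimage_merge hπ3 hΦ hF₀ hSA
  -- pair-set bookkeeping
  have hF₀S : (↑F₀ : Set (Sym2 (Fin n))) ⊆ (↑S₀.sym2 : Set (Sym2 (Fin n)))ᶜ := by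
    intro e he heS
    rw [Finset.mem_coe] at he heS
    revert he heS
    induction e using Sym2.ind with
    | _ x y =>
    intro he heS
    rw [Finset.mk_mem_sym2_iff] at heS
    rcases (hF₀ x y).1 he with ⟨-, hy, -⟩ | ⟨-, hx, -⟩
    exacts [hy heS.2, hx heS.1]
  have hES : (↑(S₀.sym2 ∪ F₀)ᶜ : Set (Sym2 (Fin n))) ⊆ (↑S₀.sym2 : Set (Sym2 (Fin n)))ᶜ := by
    intro e he heS
    rw [Finset.coe_compl, mem_compl_iff, Finset.coe_union, mem_union] at he
    exact he (Or.inl heS)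
  have hEF : (↑(S₀.sym2 ∪ F₀)ᶜ : Set (Sym2 (Fin n))) ⊆ (↑F₀ : Set (Sym2 (Fin n)))ᶜ := by
    intro e he heF
    rw [Finset.coe_compl, mem_compl_iff, Finset.coe_union, mem_union] at he
    exact he (Or.inr heF)
  -- independence
  have hI1 : μ.real (Span ∩ (Cl ∩ Φ ⁻¹' Bad)) = μ.real Span * μ.real (Cl ∩ Φ ⁻¹' Bad) :=
    prodBernoulli_real_inter_of_determinedBy w S₀.sym2 (determinedBy_span S₀ o)
      (((determinedBy_forall_notMem F₀).mono hF₀S).inter ((hdetΦ Bad).mono hES))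
      MeasurableSet.of_discrete MeasurableSet.of_discrete
  have hI2 : ∀ Y, μ.real (Cl ∩ Φ ⁻¹' Y) = μ.real Cl * μ.real (Φ ⁻¹' Y) := fun Y =>
    prodBernoulli_real_inter_of_determinedBy w F₀ (determinedBy_forall_notMem F₀)
      ((hdetΦ Y).mono hEF) MeasurableSet.of_discrete MeasurableSet.of_discrete
  -- `o` is one-layer in the merged world
  have hiso : ∀ x : Fin n, x ≠ o → x ∉ A → w' s(o, x) = 0 := by
    intro x hxo hxA
    have h := hw' s(o, x)
    rw [Finset.filter_eq_empty_iff.2 (fun e _ => merge_ne_some hπ3 ho hxA hxo e),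
      Finset.prod_empty, sub_self] at h
    exact Set.Icc.coe_eq_zero.1 h
  -- a relay with positive merged weight from `o` is a port of `S₀`
  have hport : ∀ p ∈ A, w' s(o, p) ≠ 0 → ∃ x ∈ S₀, w s(x, p) ≠ 0 := by
    intro p hp hwp
    by_contra hno
    push Not at hno
    apply hwp
    have h := hw' s(o, p)
    have hprod : ∏ e ∈ Finset.univ.filter (fun e => π e = some s(o, p)), (1 - (w e : ℝ)) = 1 := by
      refine Finset.prod_eq_one fun e he => ?_
      rw [Finset.mem_filter] at he
      obtain ⟨-, he⟩ := he
      revert he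
      induction e using Sym2.ind with
      | _ x y =>
      intro he
      rcases hπ3 x y _ he with ⟨hx, hy, hk⟩ | ⟨hx, -, hk⟩ | ⟨hy, -, hk⟩
      · exfalso
        have : o ∈ s(x, y) := by rw [← hk]; exact Sym2.mem_mk_left o p
        rcases Sym2.mem_iff.1 this with rfl | rfl
        exacts [hx ho, hy ho]
      · rcases Sym2.eq_iff.1 hk with ⟨-, rfl⟩ | ⟨rfl, rfl⟩
        · rw [hno x hx]; simp
        · exact absurd hp hoA
      · rcases Sym2.eq_iff.1 hk with ⟨-, rfl⟩ | ⟨rfl, rfl⟩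
        · rw [Sym2.eq_swap, hno y hy]; simp
        · exact absurd hp hoA
    rw [hprod, sub_self] at h
    exact Set.Icc.coe_eq_zero.1 h
  -- avoiding-`o` reliabilities in the merged world are avoiding-`S₀` reliabilities
  have havoid : ∀ x : Fin n, x ∉ S₀ →
      (prodBernoulli w').real (openConnIn ({o}ᶜ : Set (Fin n)) x b) =
        μ.real (openConnIn ((↑S₀ : Set (Fin n))ᶜ) x b) := by
    intro x hx
    rw [← hkey]
    congr 1
    ext ω
    exact merge_mem_openConnIn_iff hΦ' ho hx ω
  have hdom' : ∀ p ∈ A, w' s(o, p) ≠ 0 →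
      (prodBernoulli w').real (openConnIn ({o}ᶜ : Set (Fin n)) a₀ b) ≤
        (prodBernoulli w').real (openConnIn ({o}ᶜ : Set (Fin n)) p b) := by
    intro p hp hwp
    have hpS : p ∉ S₀ := fun h => Finset.disjoint_left.1 hSA h hp
    rw [havoid a₀ ha₀, havoid p hpS]
    exact hdom p hp (hport p hp hwp)
  -- the heart: Theorem 4 with witness in the merged world
  have heart : μ.real Cl * (prodBernoulli w').real Bad ≤ μ.real (Cl ∩ (openConn a₀ b)ᶜ) := by
    have h4 := KozmaNitzan2024_thm4_witness w' A o b a₀ hoA ha₀o hiso hdom'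
    set U : Set (Set (Sym2 (Fin n))) := ⋃ a' ∈ A, openConn o a' with hU
    have hBadU : Bad = U \ openConn o b := by rw [hBad, Set.sdiff_eq]
    have h1 : (prodBernoulli w').real Bad ≤ (prodBernoulli w').real (U \ openConn a₀ b) := by
      rw [hBadU]
      have e1 := measureReal_inter_add_sdiff (μ := prodBernoulli w') (s := U) (t := openConn o b)
        MeasurableSet.of_discrete (measure_ne_top _ _)
      have e2 := measureReal_inter_add_sdiff (μ := prodBernoulli w') (s := U) (t := openConn a₀ b)
        MeasurableSet.of_discrete (measure_ne_top _ _)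
      have h4' : (prodBernoulli w').real (U ∩ openConn a₀ b) ≤ (prodBernoulli w').real (U ∩ openConn o b) := by
        rw [Set.inter_comm U, Set.inter_comm U]; exact h4
      linarith
    have h2 : (prodBernoulli w').real (U \ openConn a₀ b) ≤ (prodBernoulli w').real (openConn a₀ b)ᶜ :=
      measureReal_mono (fun ω hω => hω.2)
    have h3 : μ.real Cl * (prodBernoulli w').real (openConn a₀ b)ᶜ ≤ μ.real (Cl ∩ (openConn a₀ b)ᶜ) := by
      rw [← hkey, ← hI2]
      refine measureReal_mono ?_
      rintro ω ⟨hωcl, hΦω⟩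
      refine ⟨hωcl, fun hab => hΦω ?_⟩
      exact merge_mem_openConn hΦ' hF₀ ho ha₀ hbS hab hωcl
    calc μ.real Cl * (prodBernoulli w').real Bad
        ≤ μ.real Cl * (prodBernoulli w').real (openConn a₀ b)ᶜ :=
          mul_le_mul_of_nonneg_left (h1.trans h2) measureReal_nonneg
      _ ≤ μ.real (Cl ∩ (openConn a₀ b)ᶜ) := h3
  -- assemble
  have hsub : Bad ∩ Pock ⊆ Span ∩ (Cl ∩ Φ ⁻¹' Bad) := fun ω ⟨hbad, hω⟩ =>
    ⟨fun v hv => mem_openConnIn_of_pocket hω hv, fun e he => notMem_of_pocket hF₀ hω he,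
      merge_mem_bad hΦ' hF₀ ho hSA hbad hω⟩
  calc μ.real (Bad ∩ Pock) ≤ μ.real (Span ∩ (Cl ∩ Φ ⁻¹' Bad)) := measureReal_mono hsub
    _ = μ.real Span * (μ.real Cl * (prodBernoulli w').real Bad) := by rw [hI1, hI2, hkey]
    _ ≤ μ.real Span * μ.real (Cl ∩ (openConn a₀ b)ᶜ) :=
        mul_le_mul_of_nonneg_left heart measureReal_nonneg

/-- The boundary-closed event written with the boundary pair set `F₀` is the event "every pair from `S₀` to a
vertex outside `S₀ ∪ A` is closed". [folklore] -/
theorem closedEvent_eq {S₀ A : Finset (Fin n)} {F₀ : Finset (Sym2 (Fin n))}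
    (hF₀ : ∀ x y, s(x, y) ∈ F₀ ↔ (x ∈ S₀ ∧ y ∉ S₀ ∧ y ∉ A) ∨ (y ∈ S₀ ∧ x ∉ S₀ ∧ x ∉ A)) :
    {ω : Set (Sym2 (Fin n)) | ∀ e ∈ F₀, e ∉ ω} =
      {ω | ∀ x ∈ S₀, ∀ y : Fin n, y ∉ S₀ → y ∉ A → s(x, y) ∉ ω} := by
  ext ω
  simp only [mem_setOf_eq]
  constructor
  · intro h x hx y hy hyA
    exact h _ ((hF₀ x y).2 (Or.inl ⟨hx, hy, hyA⟩))
  · intro h e he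
    revert he
    induction e using Sym2.ind with
    | _ x y =>
    intro he
    rcases (hF₀ x y).1 he with ⟨hx, hy, hyA⟩ | ⟨hy, hx, hxA⟩
    · exact h x hx y hy hyA
    · rw [Sym2.eq_swap]; exact h y hy x hx hxA

end Main

end PocketWitness

open PocketWitness in
/-- **THE POCKET BOUND WITH ITS WITNESS** (engine seat, 2026-08-20): for every finite weighted graph, relays `A`,
observer `o ∉ A`, target `b`, and every RULE `a` assigning to each pocket value `S₀ ∋ o` (disjoint from `A`) a vertex
`a S₀ ∉ S₀` at most as connected to `b` avoiding `S₀` as every port of `S₀`: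
`μ(o ↔ A, o ↮ b) ≤ Σ_{S₀ ∋ o, S₀ ∩ A = ∅} min( μ(P = S₀), μ(S₀ internally o-spanned) · μ({∂S₀ closed} ∩ {a S₀ ↮ b}) )`.
Designation-explicit form of the tree's `pocketBound`; b-form of the selection inequality (SEL). [this file] -/
theorem pocketWitnessBound :
    ∀ (n : ℕ) (w : Sym2 (Fin n) → unitInterval) (A : Finset (Fin n)) (o b : Fin n)
      (a : Finset (Fin n) → Fin n), o ∉ A →
      (∀ S₀ : Finset (Fin n), o ∈ S₀ → Disjoint S₀ A → a S₀ ∉ S₀ ∧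
        ∀ p ∈ A, (∃ x ∈ S₀, w s(x, p) ≠ 0) →
          (Literature.Probability.LatticeModels.prodBernoulli w).real
              (Literature.Probability.Percolation.openConnIn ((↑S₀ : Set (Fin n))ᶜ) (a S₀) b) ≤
            (Literature.Probability.LatticeModels.prodBernoulli w).real
              (Literature.Probability.Percolation.openConnIn ((↑S₀ : Set (Fin n))ᶜ) p b)) →
      (Literature.Probability.LatticeModels.prodBernoulli w).real
          ((⋃ x ∈ A, Literature.Probability.Percolation.openConn o x) ∩
            (Literature.Probability.Percolation.openConn o b)ᶜ) ≤
        ∑ S₀ ∈ (Finset.univ : Finset (Finset (Fin n))).filter (fun S₀ => o ∈ S₀ ∧ Disjoint S₀ A),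
          min ((Literature.Probability.LatticeModels.prodBernoulli w).real
                {ω | ∀ v : Fin n, ω ∈ Literature.Probability.Percolation.openConnIn (↑A)ᶜ o v ↔ v ∈ S₀})
              ((Literature.Probability.LatticeModels.prodBernoulli w).real
                  {ω | ∀ v ∈ S₀, ω ∈ Literature.Probability.Percolation.openConnIn ↑S₀ o v} *
                (Literature.Probability.LatticeModels.prodBernoulli w).real
                  ({ω | ∀ x ∈ S₀, ∀ y : Fin n, y ∉ S₀ → y ∉ A → s(x, y) ∉ ω} ∩
                    (Literature.Probability.Percolation.openConn (a S₀) b)ᶜ)) := by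
  intro n w A o b a hoA hrule
  set Bad : Set (Set (Sym2 (Fin n))) := (⋃ x ∈ A, openConn o x) ∩ (openConn o b)ᶜ with hBad
  have hoU : o ∈ (↑A : Set (Fin n))ᶜ := fun h => hoA (Finset.mem_coe.1 h)
  -- partition according to the value of the pocket
  have hcover : Bad ⊆ ⋃ S₀ ∈ (Finset.univ : Finset (Finset (Fin n))).filter
      (fun S₀ => o ∈ S₀ ∧ Disjoint S₀ A),
      (Bad ∩ {ω | ∀ v : Fin n, ω ∈ openConnIn (↑A : Set (Fin n))ᶜ o v ↔ v ∈ S₀}) := by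
    intro ω hω
    simp only [mem_iUnion, exists_prop, Finset.mem_filter, Finset.mem_univ, true_and]
    refine ⟨Finset.univ.filter (fun v => ω ∈ openConnIn (↑A : Set (Fin n))ᶜ o v), ⟨?_, ?_⟩,
      hω, fun v => by simp⟩
    · simp only [Finset.mem_filter, Finset.mem_univ, true_and]
      exact ⟨hoU, hoU, SimpleGraph.Reachable.refl _⟩
    · refine Finset.disjoint_left.2 fun v hv hvA => ?_
      simp only [Finset.mem_filter, Finset.mem_univ, true_and] at hv
      obtain ⟨-, hvU, -⟩ := hv
      exact hvU (Finset.mem_coe.2 hvA)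
  refine le_trans (measureReal_mono hcover (measure_ne_top _ _))
    (le_trans (measureReal_biUnion_finset_le _ _) ?_)
  refine Finset.sum_le_sum fun S₀ hS₀ => ?_
  simp only [Finset.mem_filter, Finset.mem_univ, true_and] at hS₀
  obtain ⟨hoS, hSA⟩ := hS₀
  refine le_min (measureReal_mono Set.inter_subset_right) ?_
  obtain ⟨π, hπ1, hπ2, hπ3⟩ := exists_mergeFiber S₀ A o hSA
  obtain ⟨w', hw'⟩ := exists_fiberWeights w π
  obtain ⟨F₀, hF₀⟩ := exists_boundaryPairs S₀ A
  obtain ⟨haS, hdom⟩ := hrule S₀ hoS hSA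
  have key := pocket_term_le_witness w hoS hSA hπ1 hπ2 hπ3
    (Φ := fun ω => {k | ∃ e ∈ ω, π e = some k}) (fun _ _ => Iff.rfl) hw' hF₀ haS hdom (b := b)
  rw [closedEvent_eq hF₀] at key
  exact key

/-- **The tree's POCKET BOUND, unconditionally** (its depth-one-gluing hypothesis discharged by Kozma–Nitzan's
Theorem 4 with witness): if `μ(a ↮ b) ≤ t` for every relay then
`μ(o ↔ A, o ↮ b) ≤ Σ_{S₀ ∋ o, S₀ ∩ A = ∅} min( μ(P = S₀), t · μ(S₀ internally o-spanned) )`.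
Witness for `S₀`: the relay least connected to `b` avoiding `S₀`. [this file] -/
theorem pocketBound_holds :
    ∀ (n : ℕ) (w : Sym2 (Fin n) → unitInterval) (A : Finset (Fin n)) (o b : Fin n) (t : ℝ),
      0 ≤ t → o ∉ A →
      (∀ a ∈ A, (Literature.Probability.LatticeModels.prodBernoulli w).real
          (Literature.Probability.Percolation.openConn a b)ᶜ ≤ t) →
      (Literature.Probability.LatticeModels.prodBernoulli w).real
          ((⋃ a ∈ A, Literature.Probability.Percolation.openConn o a) ∩
            (Literature.Probability.Percolation.openConn o b)ᶜ) ≤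
        ∑ S₀ ∈ (Finset.univ : Finset (Finset (Fin n))).filter (fun S₀ => o ∈ S₀ ∧ Disjoint S₀ A),
          min ((Literature.Probability.LatticeModels.prodBernoulli w).real
                {ω | ∀ v : Fin n, ω ∈ Literature.Probability.Percolation.openConnIn (↑A)ᶜ o v ↔ v ∈ S₀})
              (t * (Literature.Probability.LatticeModels.prodBernoulli w).real
                {ω | ∀ v ∈ S₀, ω ∈ Literature.Probability.Percolation.openConnIn ↑S₀ o v}) := by
  intro n w A o b t ht hoA hrel
  set μ := prodBernoulli w with hμ
  rcases A.eq_empty_or_nonempty with hAe | hAne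
  · -- no relay: the bad event is empty
    have h0 : ((⋃ a ∈ A, openConn o a) ∩ (openConn o b)ᶜ : Set (Set (Sym2 (Fin n)))) = ∅ := by
      rw [hAe]; simp
    rw [h0, measureReal_empty]
    exact Finset.sum_nonneg fun S₀ _ => le_min measureReal_nonneg (mul_nonneg ht measureReal_nonneg)
  -- the witness rule: the relay least connected to `b` avoiding `S₀`
  have hex : ∀ S₀ : Finset (Fin n), ∃ a₀ ∈ A, ∀ p ∈ A,
      μ.real (openConnIn ((↑S₀ : Set (Fin n))ᶜ) a₀ b) ≤ μ.real (openConnIn ((↑S₀ : Set (Fin n))ᶜ) p b) :=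
    fun S₀ => A.exists_min_image (fun x => μ.real (openConnIn ((↑S₀ : Set (Fin n))ᶜ) x b)) hAne
  choose a haA hamin using hex
  have hrule : ∀ S₀ : Finset (Fin n), o ∈ S₀ → Disjoint S₀ A → a S₀ ∉ S₀ ∧
      ∀ p ∈ A, (∃ x ∈ S₀, w s(x, p) ≠ 0) →
        μ.real (openConnIn ((↑S₀ : Set (Fin n))ᶜ) (a S₀) b) ≤ μ.real (openConnIn ((↑S₀ : Set (Fin n))ᶜ) p b) :=
    fun S₀ _ hSA => ⟨fun h => Finset.disjoint_left.1 hSA h (haA S₀), fun p hp _ => hamin S₀ p hp⟩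
  refine (pocketWitnessBound n w A o b a hoA hrule).trans (Finset.sum_le_sum fun S₀ _ => ?_)
  refine min_le_min le_rfl ?_
  rw [mul_comm t]
  refine mul_le_mul_of_nonneg_left ?_ measureReal_nonneg
  exact le_trans (measureReal_mono Set.inter_subset_right) (hrel (a S₀) (haA S₀))

end Summit.CriticalPhenomena.PercolationContinuityZ3.Theorems
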